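import Summits.Ventures.YMGap.Census.CharacterTwistBound
import HarnessLib

/-!
# Venture YMGap, track (b) — reflection positivity with a general character weight on the crossing
# plaquettes (the common core of Tomboulis's App. A RP arguments), every spin cut-off

HONEST FRAMING: venture file of the cell `pub-ymgap` (QuantumFields programme), track (b); bookkeeping generalising
`CharacterTwistBound` (finite tori `(ℤ/Lℤ)^d`, `L` even; nothing about (5.15), limits, confinement or a mass gap).

`CharacterTwistBound.tSector_nonneg` proves `∫ ∏_p w_p(U_p) dU ≥ 0` when the non-crossing plaquettes carry the
plaquette function `f = 1 + Σ_j d_j c_j χ_j` and the crossing ones the `Q`-sector weights of Tomboulis's (A.18).  The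
same Osterwalder–Seiler argument (split `G(U) G(ΘU) W_×(U)`, Haar substitution `translate Y` on the crossing links,
every character kernel an INTEGRAL Gram form `χ_n(g h⁻¹) = (n+1) ∫ χ_n(gR) χ_n(hR) dR` by the character convolution
identity of the venture `LatticeQCDFlow`, Fubini, `LatticeRP.integral_splice_mul_conj_comp_nonneg`) proves it for
ARBITRARY non-negative character sums `Σ_{n ≤ J} a_{p,n} χ_n(U_p)` on the crossing plaquettes — and needs NO sign
condition on the coefficients `c_j` of `f` off the reflection planes (they only enter through `|∫ G …|²`).  This file
records that general statement, `crossIntegral_nonneg`, and its first use beyond Prop. IV.1: the **marked-plaquette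
integral** `∫ d_j χ_j(U_{p₀}) ∏_{p ≠ p₀} f(U_p) dU ≥ 0` for a crossing plaquette `p₀` and `c_j ≥ 0`
(`markedIntegral_nonneg_of_isCrossPlaq`) — the building block of Tomboulis's Prop. II.1 (i) (arXiv:0707.2179 eq. (2.12):
`Z_Λ({c_j})` is increasing in each `c_j`, "from reflection positivity (in planes without sites)"), see
`CoeffMonotone.lean`.

## Main statements (namespace `Summit.Ventures.YMGap.Census`)

* `charSum J a r = Σ_{n ≤ J} a n · charR n r`; `crossWeight J c a p` (crossing `p`: `charSum J (a p)`, else `fR J c`);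
  `crossIntegral J c a = ∫ ∏_p crossWeight (Re tr U_p) dU`.
* `crossIntegral_nonneg` — `L` even, `a ≥ 0` ⟹ `0 ≤ crossIntegral J c a` (every `c`).
* `markedIntegral J c k p₀ = ∫ (k+1) χ_k(U_{p₀}) ∏_{p ≠ p₀} f(U_p) dU`;
  `markedIntegral_nonneg_of_isCrossPlaq` — `L` even, `c_j ≥ 0`, `1 ≤ k ≤ J`, `p₀` crossing ⟹ `0 ≤ markedIntegral`.

References: E. T. Tomboulis, arXiv:0707.2179, Prop. II.1 eq. (2.12), App. A [cite: Tomboulis2007Confinement, Prop. II.1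
(i) eq. (2.12); App. A]; K. Osterwalder, E. Seiler, Ann. Phys. 110 (1978) 440, §2 [cite: OsterwalderSeilerAnnPhys1978, §2].
-/

noncomputable section

open MeasureTheory Finset Real
open scoped BigOperators ComplexConjugate
open Literature.MathematicalPhysics.QuantumLattice
open Literature.MathematicalPhysics.QuantumFieldTheory
open Literature.MathematicalPhysics.QuantumFieldTheory.Tomboulis2007
open Literature.MathematicalPhysics.QuantumFieldTheory.WilsonRP
open Summit.Ventures.LatticeQCDFlow.Exactness

namespace Summit.Ventures.YMGap.Census

variable {d L : ℕ}

/-! ### General character sums -/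

/-- A character sum with spin cut-off `J` and coefficient vector `a`: `Σ_{n=0}^{J} a_n charR n r`. -/
def charSum (J : ℕ) (a : ℕ → ℝ) (r : ℝ) : ℝ :=
  ∑ n ∈ Finset.range (J + 1), a n * charR n r

/-- The coefficients of the plaquette function `f = 1 + Σ_{j≠0} d_j c_j χ_j` (`n = 0 ↦ 1`, `n ↦ (n+1) c_n`). -/
def stdCoef (c : ℕ → ℝ) (n : ℕ) : ℝ :=
  if n = 0 then 1 else ((n : ℝ) + 1) * c n

/-- `stdCoef c ≥ 0` when `c_j ≥ 0` for `j ≠ 0`. -/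
theorem stdCoef_nonneg {c : ℕ → ℝ} (hc : ∀ n, 1 ≤ n → 0 ≤ c n) (n : ℕ) : 0 ≤ stdCoef c n := by
  unfold stdCoef
  split_ifs with h0
  · exact zero_le_one
  · exact mul_nonneg (by positivity) (hc n (Nat.one_le_iff_ne_zero.mpr h0))

/-- `charSum J (stdCoef c) = fR J c` (the plaquette function). -/
theorem charSum_stdCoef (J : ℕ) (c : ℕ → ℝ) (r : ℝ) : charSum J (stdCoef c) r = fR J c r := by
  unfold charSum fR
  rw [sum_range_succ_eq_add_sum_Icc]
  congr 1
  · simp [stdCoef, charR_zero]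
  · refine Finset.sum_congr rfl fun n hn => ?_
    have hn0 : n ≠ 0 := by have := (Finset.mem_Icc.1 hn).1; omega
    simp [stdCoef, hn0]

/-- The coefficient vector of the single character `(k+1) χ_k` (`d_j χ_j`, `k = 2j`). -/
def singleCoef (k : ℕ) (n : ℕ) : ℝ :=
  if n = k then ((k : ℝ) + 1) else 0

/-- `singleCoef k ≥ 0`. -/
theorem singleCoef_nonneg (k n : ℕ) : 0 ≤ singleCoef k n := by
  unfold singleCoef
  split_ifs
  · positivity
  · exact le_rfl

/-- `charSum J (singleCoef k) r = (k+1) charR k r` for `k ≤ J`. -/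
theorem charSum_singleCoef {J k : ℕ} (hkJ : k ≤ J) (r : ℝ) : charSum J (singleCoef k) r = ((k : ℝ) + 1) * charR k r := by
  unfold charSum singleCoef
  have hk : k ∈ Finset.range (J + 1) := Finset.mem_range.2 (Nat.lt_succ_of_le hkJ)
  rw [Finset.sum_eq_single_of_mem k hk (fun n _ hn => by rw [if_neg hn, zero_mul]), if_pos rfl]

/-- `charSum J a` is continuous. -/
theorem continuous_charSum (J : ℕ) (a : ℕ → ℝ) : Continuous (charSum J a) := by
  unfold charSum
  exact continuous_finsetSum _ fun n _ => continuous_const.mul (continuous_charR n)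

section RP

variable [NeZero d] [NeZero L] [Fact (1 < L)]

/-! ### The weight configuration and the integral -/

/-- The weight of plaquette `p`: the general character sum `charSum J (a p)` on crossing plaquettes, the plaquette
function `f` elsewhere. -/
def crossWeight (J : ℕ) (c : ℕ → ℝ) (a : Plaquette d L → ℕ → ℝ) (p : Plaquette d L) (r : ℝ) : ℝ :=
  if IsCrossPlaq p then charSum J (a p) r else fR J c r

/-- `∫ ∏_p crossWeight_p(Re tr U_p) dU`. -/
def crossIntegral (J : ℕ) (c : ℕ → ℝ) (a : Plaquette d L → ℕ → ℝ) : ℝ :=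
  ∫ W, ∏ p, crossWeight J c a p (plaqRe rhoFund W p) ∂(LatticeRP.piMeasure (haarProbability SU2))

/-- **The split `∏_p w_p(U) = G(U) G(ΘU) ∏_{p crossing} charSum_p(U_p)`.** -/
theorem prod_crossWeight_split (hL : Even L) (J : ℕ) (c : ℕ → ℝ) (a : Plaquette d L → ℕ → ℝ)
    (W : GaugeConfig d L SU2) :
    ∏ p : Plaquette d L, crossWeight J c a p (plaqRe rhoFund W p) =
      gPosJ J c W * gPosJ J c W.timeReflect *
        ∏ p ∈ univ.filter IsCrossPlaq, charSum J (a p) (plaqRe rhoFund W p) := by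
  rw [← Finset.prod_filter_mul_prod_filter_not univ IsCrossPlaq, mul_comm]
  unfold gPosJ
  congr 1
  · have hw : ∀ p ∈ univ.filter (fun p => ¬ IsCrossPlaq p),
        crossWeight J c a p (plaqRe rhoFund W p) = fR J c (plaqRe rhoFund W p) := fun p hp => by
      simp [crossWeight, (Finset.mem_filter.mp hp).2]
    rw [Finset.prod_congr rfl hw,
      ← Finset.prod_filter_mul_prod_filter_not (univ.filter fun p => ¬ IsCrossPlaq p) IsPosPlaq,
      Finset.filter_filter, Finset.filter_filter]
    have hpos : univ.filter (fun p : Plaquette d L => ¬ IsCrossPlaq p ∧ IsPosPlaq p) = univ.filter IsPosPlaq :=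
      Finset.filter_congr fun p _ =>
        ⟨fun h => h.2, fun h => ⟨fun hc => not_isPosPlaq_of_isCrossPlaq hL hc h, h⟩⟩
    have hneg : univ.filter (fun p : Plaquette d L => ¬ IsCrossPlaq p ∧ ¬ IsPosPlaq p) =
        univ.filter IsNegPlaq :=
      Finset.filter_congr fun p _ => ⟨fun h => ⟨h.2, h.1⟩, fun h => ⟨h.2, h.1⟩⟩
    rw [hpos, hneg, prod_neg_eq_prod_pos_timeReflect hL (fR J c) W]
  · exact Finset.prod_congr rfl fun p hp => by simp [crossWeight, (Finset.mem_filter.mp hp).2]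

/-! ### The Gram expansion with general coefficients -/

/-- The Gram weights: `a_p(n) · (n+1)` on crossing plaquettes, `[n = 0]` elsewhere. -/
def gWtA (a : Plaquette d L → ℕ → ℝ) (p : Plaquette d L) (n : ℕ) : ℝ :=
  if IsCrossPlaq p then a p n * ((n : ℝ) + 1) else (if n = 0 then 1 else 0)

omit [NeZero L] [Fact (1 < L)] in
/-- The Gram weights are non-negative when `a ≥ 0`. -/
theorem gWtA_nonneg {a : Plaquette d L → ℕ → ℝ} (ha : ∀ p n, 0 ≤ a p n) (p : Plaquette d L) (n : ℕ) :
    0 ≤ gWtA a p n := by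
  unfold gWtA
  split_ifs
  · exact mul_nonneg (ha p n) (by positivity)
  · exact zero_le_one
  · exact le_rfl

/-- **The Gram identity for one plaquette, general coefficients**: after `translate Y` the factor of a crossing
plaquette is `Σ_n gWtA_p(n) ∫ feat_{p,n}(R, z) feat_{p,n}(R, ΘU) dR`; the trivial factor of a non-crossing plaquette
has the same form. -/
theorem cross_factorA (hL : Even L) (J : ℕ) (a : Plaquette d L → ℕ → ℝ) (W Y : GaugeConfig d L SU2)
    (p : Plaquette d L) :
    (if IsCrossPlaq p then charSum J (a p) (plaqRe rhoFund (translate Y W) p) else 1) =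
      ∑ n ∈ Finset.range (J + 1), gWtA a p n *
        ∫ R, feat p n R (LatticeRP.splice crossEdges (W, Y)) * feat p n R W.timeReflect
          ∂(haarProbability SU2) := by
  by_cases hp : IsCrossPlaq p
  · rw [if_pos hp]
    unfold charSum
    refine Finset.sum_congr rfl fun n _ => ?_
    have hr : charR n (plaqRe rhoFund (translate Y W) p) =
        (Polynomial.Chebyshev.U ℝ (n : ℤ)).eval
          (su2a0 (halfPlaq p (LatticeRP.splice crossEdges (W, Y)) * (halfPlaq p W.timeReflect)⁻¹)) := by
      rw [charR, plaqRe_translate_eq_two_mul_su2a0 hL W Y hp, mul_div_cancel_left₀ _ two_ne_zero]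
    simp only [gWtA, feat, if_pos hp]
    rw [hr, charKernel_eq_integral]
    ring
  · rw [if_neg hp]
    simp [gWtA, feat, hp]

/-- The crossing product after `translate Y`, general coefficients:
`∏_{p crossing} charSum_p = Σ_x Γ_x ∫_{R⃗} Ψ_x(z, R⃗) Ψ_x(ΘU, R⃗) dR⃗`. -/
theorem wCrossA_translate (hL : Even L) (J : ℕ) (a : Plaquette d L → ℕ → ℝ) (W Y : GaugeConfig d L SU2) :
    ∏ p ∈ univ.filter IsCrossPlaq, charSum J (a p) (plaqRe rhoFund (translate Y W) p) =
      ∑ x ∈ Fintype.piFinset (fun _ : Plaquette d L => Finset.range (J + 1)),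
        (∏ p, gWtA a p (x p)) *
          ∫ Rv, (∏ p, feat p (x p) (Rv p) (LatticeRP.splice crossEdges (W, Y))) *
            (∏ p, feat p (x p) (Rv p) W.timeReflect)
            ∂(Measure.pi fun _ : Plaquette d L => haarProbability SU2) := by
  rw [Finset.prod_filter, Finset.prod_congr rfl fun p _ => cross_factorA hL J a W Y p, Finset.prod_univ_sum]
  refine Finset.sum_congr rfl fun x _ => ?_
  rw [Finset.prod_mul_distrib]
  congr 1
  rw [← integral_fintype_prod_eq_prod
    (fun p R => feat p (x p) R (LatticeRP.splice crossEdges (W, Y)) * feat p (x p) R W.timeReflect)]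
  refine integral_congr_ae (ae_of_all _ fun Rv => ?_)
  simp only [Finset.prod_mul_distrib]

/-- The tripled integrand with general Gram weights. -/
def MintA (J : ℕ) (c : ℕ → ℝ) (a : Plaquette d L → ℕ → ℝ)
    (q : GaugeConfig d L SU2 × GaugeConfig d L SU2) (Rv : Plaquette d L → SU2) : ℝ :=
  ∑ x ∈ Fintype.piFinset (fun _ : Plaquette d L => Finset.range (J + 1)),
    (∏ p, gWtA a p (x p)) *
      (PhiX J c x Rv (LatticeRP.splice crossEdges q) * PhiX J c x Rv (GaugeConfig.timeReflect q.1))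

omit [Fact (1 < L)] in
/-- The tripled integrand is jointly continuous. -/
theorem continuous_MintA (J : ℕ) (c : ℕ → ℝ) (a : Plaquette d L → ℕ → ℝ) :
    Continuous (Function.uncurry (MintA (d := d) (L := L) J c a)) := by
  have h : Function.uncurry (MintA (d := d) (L := L) J c a) =
      fun z => ∑ x ∈ Fintype.piFinset (fun _ : Plaquette d L => Finset.range (J + 1)),
        (∏ p, gWtA a p (x p)) *
          (PhiX J c x z.2 (LatticeRP.splice crossEdges z.1) * PhiX J c x z.2 (GaugeConfig.timeReflect z.1.1)) := by
    funext z
    rfl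
  rw [h]
  refine continuous_finsetSum _ fun x _ => ?_
  have h1 : Continuous fun z : (GaugeConfig d L SU2 × GaugeConfig d L SU2) × (Plaquette d L → SU2) =>
      PhiX J c x z.2 (LatticeRP.splice crossEdges z.1) :=
    continuous_PhiX_comp J c x ((continuous_splice crossEdges).comp continuous_fst) continuous_snd
  have h2 : Continuous fun z : (GaugeConfig d L SU2 × GaugeConfig d L SU2) × (Plaquette d L → SU2) =>
      PhiX J c x z.2 (GaugeConfig.timeReflect z.1.1) :=
    continuous_PhiX_comp J c x (continuous_timeReflect.comp (continuous_fst.comp continuous_fst))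
      continuous_snd
  exact continuous_const.mul (h1.mul h2)

/-- **The pointwise identity** after `translate Y`: `∏_p w_p(translate Y U) = ∫ MintA((U, Y), R⃗) dR⃗`. -/
theorem integrand_translateA (hL : Even L) (J : ℕ) (c : ℕ → ℝ) (a : Plaquette d L → ℕ → ℝ)
    (W Y : GaugeConfig d L SU2) :
    ∏ p : Plaquette d L, crossWeight J c a p (plaqRe rhoFund (translate Y W) p) =
      ∫ Rv, MintA J c a (W, Y) Rv ∂(Measure.pi fun _ : Plaquette d L => haarProbability SU2) := by
  haveI : SecondCountableTopology SU2 := secondCountableTopology_su2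
  have hPC : ∀ e : Edge d L, IsPosEdge e → ¬ IsCrossEdge e :=
    fun e he hc => not_isPosEdge_of_isCrossEdge hL hc he
  have hmem : ∀ e : Edge d L, e ∈ ((posEdges : Finset (Edge d L)) : Set (Edge d L)) → IsPosEdge e :=
    fun e he => by simpa using he
  have htr : ∀ e ∈ ((posEdges : Finset (Edge d L)) : Set (Edge d L)), translate Y W e = W e :=
    fun e he => translate_apply_of_not_isCrossEdge Y W (hPC e (hmem e he))
  have hsp : ∀ e ∈ ((posEdges : Finset (Edge d L)) : Set (Edge d L)),
      LatticeRP.splice crossEdges (W, Y) e = W e :=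
    fun e he => splice_apply_of_not_isCrossEdge W Y (hPC e (hmem e he))
  have hΘtr : ∀ e ∈ ((posEdges : Finset (Edge d L)) : Set (Edge d L)),
      (translate Y W).timeReflect e = W.timeReflect e := by
    intro e he
    rw [timeReflect_apply, timeReflect_apply,
      translate_apply_of_not_isCrossEdge Y W (not_isCrossEdge_edgeReflect hL (hmem e he))]
  have hG1 : gPosJ J c (translate Y W) = gPosJ J c (LatticeRP.splice crossEdges (W, Y)) := by
    rw [gPosJ_congr J c htr, ← gPosJ_congr J c hsp]
  have hG2 : gPosJ J c (translate Y W).timeReflect = gPosJ J c W.timeReflect := gPosJ_congr J c hΘtr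
  rw [prod_crossWeight_split hL J c a, wCrossA_translate hL J a W Y, hG1, hG2, Finset.mul_sum]
  unfold MintA
  rw [integral_finsetSum _ (fun x _ =>
    (integrable_of_continuous_fin (continuous_PhiX_mul J c x (F := fun _ => LatticeRP.splice crossEdges (W, Y))
      (G := fun _ => W.timeReflect) (Rf := fun Rv => Rv) continuous_const continuous_const
      continuous_id)).const_mul _)]
  refine Finset.sum_congr rfl fun x _ => ?_
  rw [← integral_const_mul, ← integral_const_mul]
  refine integral_congr_ae (ae_of_all _ fun Rv => ?_)
  set A := ∏ p, feat p (x p) (Rv p) (LatticeRP.splice crossEdges (W, Y)) with hA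
  set B := ∏ p, feat p (x p) (Rv p) W.timeReflect with hB
  simp only [PhiX, ← hA, ← hB]
  ring

/-- **Positivity of the inner double integral** for every auxiliary configuration `R⃗`, general weights `a ≥ 0`. -/
theorem innerA_nonneg (hL : Even L) (J : ℕ) (c : ℕ → ℝ) {a : Plaquette d L → ℕ → ℝ} (ha : ∀ p n, 0 ≤ a p n)
    (Rv : Plaquette d L → SU2) :
    0 ≤ ∫ q, MintA J c a q Rv
      ∂((LatticeRP.piMeasure (haarProbability SU2)).prod (LatticeRP.piMeasure (haarProbability SU2))) := by
  haveI : SecondCountableTopology SU2 := secondCountableTopology_su2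
  unfold MintA
  rw [integral_finsetSum _ (fun x _ =>
    (integrable_of_continuous_fin (continuous_PhiX_mul J c x (F := LatticeRP.splice crossEdges)
      (G := fun q => GaugeConfig.timeReflect q.1) (Rf := fun _ => Rv) (continuous_splice crossEdges)
      (continuous_timeReflect.comp continuous_fst) continuous_const)).const_mul _)]
  refine Finset.sum_nonneg fun x _ => ?_
  rw [integral_const_mul]
  refine mul_nonneg (Finset.prod_nonneg fun p _ => gWtA_nonneg ha p (x p)) ?_
  exact rp_term_nonneg hL (Φ := PhiX J c x Rv) (continuous_PhiX J c x Rv) (dependsOn_PhiX hL J c x Rv)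

/-- **Reflection positivity with a general non-negative character weight on the crossing plaquettes**: on the even
torus, for ANY coefficient sequence `c` of the plaquette function off the reflection planes and any `a ≥ 0`,
`0 ≤ ∫ ∏_{p non-crossing} f(U_p) ∏_{p crossing} Σ_n a_{p,n} χ_n(U_p) dU`. -/
theorem crossIntegral_nonneg (hL : Even L) (J : ℕ) (c : ℕ → ℝ) {a : Plaquette d L → ℕ → ℝ}
    (ha : ∀ p n, 0 ≤ a p n) : 0 ≤ crossIntegral J c a := by
  haveI : SecondCountableTopology SU2 := secondCountableTopology_su2
  have hHc : Continuous fun W : GaugeConfig d L SU2 => ∏ p, crossWeight J c a p (plaqRe rhoFund W p) := by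
    refine continuous_finsetProd _ fun p _ => ?_
    unfold crossWeight
    split_ifs
    · exact (continuous_charSum J (a p)).comp (continuous_plaqRe p)
    · exact (continuous_fR J c).comp (continuous_plaqRe p)
  have step1 : crossIntegral J c a =
      ∫ Y, ∫ W, ∏ p, crossWeight J c a p (plaqRe rhoFund (WilsonRP.translate Y W) p)
        ∂(LatticeRP.piMeasure (haarProbability SU2)) ∂(LatticeRP.piMeasure (haarProbability SU2)) := by
    unfold crossIntegral
    simp_rw [integral_comp_translate _ hHc, integral_const, probReal_univ, one_smul]
  have step2 : ∀ Y W : GaugeConfig d L SU2,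
      ∏ p, crossWeight J c a p (plaqRe rhoFund (WilsonRP.translate Y W) p) =
        ∫ Rv, MintA J c a (W, Y) Rv ∂(Measure.pi fun _ : Plaquette d L => haarProbability SU2) :=
    fun Y W => integrand_translateA hL J c a W Y
  have hMi : Integrable (Function.uncurry (MintA J c a))
      (((LatticeRP.piMeasure (haarProbability SU2)).prod (LatticeRP.piMeasure (haarProbability SU2))).prod
        (Measure.pi fun _ : Plaquette d L => haarProbability SU2)) :=
    integrable_of_continuous_fin (continuous_MintA J c a)
  rw [step1]
  simp_rw [step2]
  rw [← integral_prod_symm (fun q => ∫ Rv, MintA J c a q Rv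
      ∂(Measure.pi fun _ : Plaquette d L => haarProbability SU2)) hMi.integral_prod_left,
    integral_integral_swap hMi]
  exact integral_nonneg fun Rv => innerA_nonneg hL J c ha Rv

/-! ### The marked-plaquette integral -/

/-- **The marked-plaquette integral** `∫ (k+1) χ_k(U_{p₀}) ∏_{p ≠ p₀} f(U_p) dU` — the `p₀`-term of
`∂Z_Λ/∂c_k` (Tomboulis's Prop. II.1 (i), eq. (2.12)); written as a product over all plaquettes with the factor of
`p₀` replaced. -/
def markedIntegral (J : ℕ) (c : ℕ → ℝ) (k : ℕ) (p₀ : Plaquette d L) : ℝ :=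
  ∫ W, ∏ p, (if p = p₀ then ((k : ℝ) + 1) * su2Char k (plaquetteHolonomy W p.1 p.2.1.1 p.2.1.2)
      else plaqFn J c (plaquetteHolonomy W p.1 p.2.1.1 p.2.1.2))
    ∂(LatticeRP.piMeasure (haarProbability SU2))

/-- The coefficient array marking `p₀` with the single character `(k+1) χ_k` and putting `f` everywhere else. -/
def markedCoef (c : ℕ → ℝ) (k : ℕ) (p₀ : Plaquette d L) (p : Plaquette d L) (n : ℕ) : ℝ :=
  if p = p₀ then singleCoef k n else stdCoef c n

omit [NeZero d] [NeZero L] [Fact (1 < L)] in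
/-- At the marked plaquette the coefficient vector is `singleCoef k`. -/
theorem markedCoef_self (c : ℕ → ℝ) (k : ℕ) (p₀ : Plaquette d L) : markedCoef c k p₀ p₀ = singleCoef k := by
  funext n
  simp [markedCoef]

omit [NeZero d] [NeZero L] [Fact (1 < L)] in
/-- Off the marked plaquette the coefficient vector is `stdCoef c`. -/
theorem markedCoef_of_ne (c : ℕ → ℝ) (k : ℕ) {p₀ p : Plaquette d L} (h : p ≠ p₀) :
    markedCoef c k p₀ p = stdCoef c := by
  funext n
  simp [markedCoef, h]

omit [NeZero d] [NeZero L] [Fact (1 < L)] in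
/-- `markedCoef ≥ 0` when `c_j ≥ 0`. -/
theorem markedCoef_nonneg {c : ℕ → ℝ} (hc : ∀ n, 1 ≤ n → 0 ≤ c n) (k : ℕ) (p₀ p : Plaquette d L) (n : ℕ) :
    0 ≤ markedCoef c k p₀ p n := by
  unfold markedCoef
  split_ifs
  · exact singleCoef_nonneg k n
  · exact stdCoef_nonneg hc n

omit [Fact (1 < L)] in
/-- For a crossing `p₀` and `k ≤ J` the marked integral is a `crossIntegral`. -/
theorem markedIntegral_eq_crossIntegral (J : ℕ) (c : ℕ → ℝ) {k : ℕ} (hkJ : k ≤ J) {p₀ : Plaquette d L}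
    (hp₀ : IsCrossPlaq p₀) : markedIntegral J c k p₀ = crossIntegral J c (markedCoef c k p₀) := by
  unfold markedIntegral crossIntegral
  refine integral_congr_ae (ae_of_all _ fun W => Finset.prod_congr rfl fun p _ => ?_)
  by_cases hp : p = p₀
  · subst hp
    rw [if_pos rfl, crossWeight, if_pos hp₀, markedCoef_self, charSum_singleCoef hkJ, su2Char_hol_eq_charR]
  · rw [if_neg hp, plaqFn_hol_eq_fR]
    unfold crossWeight
    split_ifs with hpc
    · rw [markedCoef_of_ne c k hp, charSum_stdCoef]
    · rfl

/-- **The marked-plaquette integral is non-negative for a crossing plaquette**: on the even torus, for `c_j ≥ 0`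
(`j ≠ 0`), `1 ≤ k ≤ J` and `p₀` bisected by a reflection hyperplane, `0 ≤ ∫ (k+1) χ_k(U_{p₀}) ∏_{p ≠ p₀} f(U_p) dU`
(Tomboulis's "reflection positivity in planes without sites" behind Prop. II.1 (i)). -/
theorem markedIntegral_nonneg_of_isCrossPlaq (hL : Even L) (J : ℕ) {c : ℕ → ℝ} (hc : ∀ n, 1 ≤ n → 0 ≤ c n)
    {k : ℕ} (hkJ : k ≤ J) {p₀ : Plaquette d L} (hp₀ : IsCrossPlaq p₀) : 0 ≤ markedIntegral J c k p₀ := by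
  rw [markedIntegral_eq_crossIntegral J c hkJ hp₀]
  exact crossIntegral_nonneg hL J c fun p n => markedCoef_nonneg hc k p₀ p n

end RP

end Summit.Ventures.YMGap.Census

end
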